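import Summits.CriticalPhenomena.PercolationContinuityZ3.Theorems.SahiAEBandPatch
import Summits.CriticalPhenomena.PercolationContinuityZ3.Theorems.SahiAEEnvelopeAddenda

/-!
# Open bands in every dimension: geometry and generic pairs

Support file of the Sahi cell (`prim-sahi`, typer seat, generation 25; `--supports stmt-CriticalPhenomena-4575`).
Two small definitions (`IsOpenBand`, `armBox`), theorems otherwise; no named facts, no sorries.

This is the second file of the structure theorem for densities WITH ZEROS in every dimension (the planar case is
`SahiAEPlaneZeros.lean`, generation 24).  An **open band** `U ⊆ ℝ^ι` (`IsOpenBand`) is an open sublattice all of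
whose axis-parallel sections `{t | (x; i := t) ∈ U}` are order-convex; in the plane this is `Plane.IsBand`.  After
the coordinatewise quantile transport, the support of an a.e.-MTP₂ density is almost such a set
(`SahiAEOpenBandSupport.lean`).  Here:

* geometry: the closed box spanned by a point `c ∈ U` and its arms `(c; i := pᵢ) ∈ U` lies in `U`
  (`IsOpenBand.Icc_subset`); the **arm box** `armBox U c` (an open box inside `U`); every point of `U` lies in the
  arm box of a member of any dense family (`IsOpenBand.exists_mem_armBox`); base points slightly below a point of `U`
  whose `i`-lines stay in `U` (`IsOpenBand.exists_below_line`); the one-sided dichotomy for order-convex subsets of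
  `ℝ` (`eventually_mem_or_eventually_not_mem_nhdsLT`);
* generic pairs relative to `U`: the pull-back of an a.e. statement on pairs along
  `((c, c'), (r, t)) ↦ ((c; i := r), (c'; i := t))` for an ARBITRARY predicate (`ae_pair_update`, the proof of
  `ae_pair_generic` verbatim).

No sorries, no new axioms.
-/

noncomputable section

namespace Summit.CriticalPhenomena.PercolationContinuityZ3.Theorems.SahiAEFourFunctions

open MeasureTheory Set Filter Topology Function Metric
open Summit.CriticalPhenomena.PercolationContinuityZ3.Theorems.SahiAESeparableTilt
open scoped ENNReal NNReal

variable {ι : Type*} [Fintype ι] [DecidableEq ι]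

/-! ### Pull-back of almost-everywhere statements on pairs to parallel axis lines -/

/-- **Generic pairs of base points for an arbitrary predicate**: if `P` holds at almost every pair of points of `ℝ^ι`
then for almost every `c`, almost every `c'`, every `i` and almost every `(r, t)` it holds at
`((c; i := r), (c'; i := t))` (the proof of `ae_pair_generic`, verbatim). [this work] -/
theorem ae_pair_update {P : (ι → ℝ) × (ι → ℝ) → Prop}
    (h : ∀ᵐ p ∂(volume : Measure (ι → ℝ)).prod volume, P p) :
    ∀ᵐ c ∂(volume : Measure (ι → ℝ)), ∀ᵐ c' ∂(volume : Measure (ι → ℝ)), ∀ i,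
      ∀ᵐ rt ∂(volume : Measure ℝ).prod (volume : Measure ℝ), P (update c i rt.1, update c' i rt.2) := by
  have H : ∀ i, ∀ᵐ c ∂(volume : Measure (ι → ℝ)), ∀ᵐ c' ∂(volume : Measure (ι → ℝ)),
      ∀ᵐ rt ∂(volume : Measure ℝ).prod (volume : Measure ℝ), P (update c i rt.1, update c' i rt.2) := by
    intro i
    have hU := quasiMeasurePreserving_update (ι := ι) i
    have hUU : Measure.QuasiMeasurePreserving
        (Prod.map (fun p : (ι → ℝ) × ℝ => update p.1 i p.2) (fun p : (ι → ℝ) × ℝ => update p.1 i p.2))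
        (((volume : Measure (ι → ℝ)).prod (volume : Measure ℝ)).prod
          ((volume : Measure (ι → ℝ)).prod (volume : Measure ℝ)))
        ((volume : Measure (ι → ℝ)).prod volume) := MeasureTheory.QuasiMeasurePreserving.prodMap hU hU
    have hσ : MeasurePreserving
        (fun w : (ℝ × ℝ) × ((ι → ℝ) × (ι → ℝ)) => ((w.2.1, w.1.1), (w.2.2, w.1.2)))
        (((volume : Measure ℝ).prod (volume : Measure ℝ)).prod
          ((volume : Measure (ι → ℝ)).prod (volume : Measure (ι → ℝ))))
        (((volume : Measure (ι → ℝ)).prod (volume : Measure ℝ)).prod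
          ((volume : Measure (ι → ℝ)).prod (volume : Measure ℝ))) :=
      measurePreserving_shuffle (volume : Measure ℝ) (volume : Measure ℝ) (volume : Measure (ι → ℝ))
        (volume : Measure (ι → ℝ))
    have hsw : MeasurePreserving (Prod.swap : ((ι → ℝ) × (ι → ℝ)) × (ℝ × ℝ) → (ℝ × ℝ) × ((ι → ℝ) × (ι → ℝ)))
        (((volume : Measure (ι → ℝ)).prod (volume : Measure (ι → ℝ))).prod
          ((volume : Measure ℝ).prod (volume : Measure ℝ)))
        (((volume : Measure ℝ).prod (volume : Measure ℝ)).prod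
          ((volume : Measure (ι → ℝ)).prod (volume : Measure (ι → ℝ)))) := Measure.measurePreserving_swap
    have hΘ : Measure.QuasiMeasurePreserving
        (fun w : ((ι → ℝ) × (ι → ℝ)) × (ℝ × ℝ) => (update w.1.1 i w.2.1, update w.1.2 i w.2.2))
        (((volume : Measure (ι → ℝ)).prod (volume : Measure (ι → ℝ))).prod
          ((volume : Measure ℝ).prod (volume : Measure ℝ)))
        ((volume : Measure (ι → ℝ)).prod volume) := by
      have e : (fun w : ((ι → ℝ) × (ι → ℝ)) × (ℝ × ℝ) => (update w.1.1 i w.2.1, update w.1.2 i w.2.2)) =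
          (Prod.map (fun p : (ι → ℝ) × ℝ => update p.1 i p.2) (fun p : (ι → ℝ) × ℝ => update p.1 i p.2)) ∘
            (fun w : (ℝ × ℝ) × ((ι → ℝ) × (ι → ℝ)) => ((w.2.1, w.1.1), (w.2.2, w.1.2))) ∘ Prod.swap := by
        funext w; rfl
      rw [e]
      exact (hUU.comp hσ.quasiMeasurePreserving).comp hsw.quasiMeasurePreserving
    have h1 : ∀ᵐ w ∂(((volume : Measure (ι → ℝ)).prod (volume : Measure (ι → ℝ))).prod
        ((volume : Measure ℝ).prod (volume : Measure ℝ))), P (update w.1.1 i w.2.1, update w.1.2 i w.2.2) := by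
      filter_upwards [hΘ.ae h] with w hw
      exact hw
    have h2 := Measure.ae_ae_of_ae_prod (p := fun w : ((ι → ℝ) × (ι → ℝ)) × (ℝ × ℝ) =>
      P (update w.1.1 i w.2.1, update w.1.2 i w.2.2)) h1
    have h3 := Measure.ae_ae_of_ae_prod (p := fun cc : (ι → ℝ) × (ι → ℝ) =>
      ∀ᵐ rt : ℝ × ℝ ∂(volume : Measure ℝ).prod (volume : Measure ℝ), P (update cc.1 i rt.1, update cc.2 i rt.2)) h2
    filter_upwards [h3] with c hc
    filter_upwards [hc] with c' hc'
    exact hc'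
  filter_upwards [ae_all_iff.2 H] with c hc
  exact ae_all_iff.2 hc

omit [DecidableEq ι] in
/-- A co-null property holds somewhere in any non-empty open set. [folklore] -/
theorem exists_of_ae_of_isOpen' {Q : (ι → ℝ) → Prop} (hQ : ∀ᵐ c ∂(volume : Measure (ι → ℝ)), Q c)
    {O : Set (ι → ℝ)} (hO : IsOpen O) (hne : O.Nonempty) : ∃ c ∈ O, Q c := by
  by_contra hcon
  push Not at hcon
  have h0 : volume O = 0 := measure_mono_null (fun c hc hq => hcon c hc hq) (ae_iff.1 hQ)
  exact (hO.measure_pos volume hne).ne' h0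

/-! ### Open bands -/

omit [Fintype ι] in
/-- **An open band of `ℝ^ι`**: an open sublattice all of whose axis-parallel sections are order-convex (in the
plane: `Plane.IsBand`). [this work] -/
structure IsOpenBand (U : Set (ι → ℝ)) : Prop where
  isOpen : IsOpen U
  inf_mem : ∀ x ∈ U, ∀ y ∈ U, x ⊓ y ∈ U
  sup_mem : ∀ x ∈ U, ∀ y ∈ U, x ⊔ y ∈ U
  ordConnected : ∀ (x : ι → ℝ) (i : ι), OrdConnected {t : ℝ | update x i t ∈ U}

omit [Fintype ι] in
/-- **The arm box** of a base point `c`: the points `p > c` whose projections `(c; i := pᵢ)` onto the axis cross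
through `c` lie in `U`. [this work] -/
def armBox (U : Set (ι → ℝ)) (c : ι → ℝ) : Set (ι → ℝ) :=
  {p | (∀ i, c i < p i) ∧ ∀ i, update c i (p i) ∈ U}

omit [Fintype ι] in
/-- Membership in an arm box. [folklore] -/
theorem mem_armBox {U : Set (ι → ℝ)} {c p : ι → ℝ} :
    p ∈ armBox U c ↔ (∀ i, c i < p i) ∧ ∀ i, update c i (p i) ∈ U := Iff.rfl

omit [Fintype ι] in
/-- Axis sections of an open set are open. [folklore] -/
theorem isOpen_lineSection {U : Set (ι → ℝ)} (hU : IsOpen U) (x : ι → ℝ) (i : ι) :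
    IsOpen {t : ℝ | update x i t ∈ U} :=
  hU.preimage (continuous_const.update i continuous_id)

omit [Fintype ι] in
/-- **Points of the axis segment from `c` to `(c; i := pᵢ)` lie in `U`.** [folklore] -/
theorem IsOpenBand.update_mem {U : Set (ι → ℝ)} (hU : IsOpenBand U) {c : ι → ℝ} (hc : c ∈ U) {i : ι} {s t : ℝ}
    (hs : update c i s ∈ U) (ht : t ∈ Icc (min (c i) s) (max (c i) s)) : update c i t ∈ U := by
  have hcc : update c i (c i) ∈ U := by rwa [update_eq_self]
  rcases le_total (c i) s with h | h
  · rw [min_eq_left h, max_eq_right h] at ht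
    exact (hU.ordConnected c i).out hcc hs ht
  · rw [min_eq_right h, max_eq_left h] at ht
    exact (hU.ordConnected c i).out hs hcc ht

/-- **The closed box spanned by a point of `U` and arms in `U` lies in `U`** (each point of the box is the join of
its projections onto the axis cross through `c`). [this work] -/
theorem IsOpenBand.Icc_subset {U : Set (ι → ℝ)} (hU : IsOpenBand U) {c p : ι → ℝ} (hc : c ∈ U)
    (harm : ∀ i, update c i (p i) ∈ U) : Icc c p ⊆ U := by
  intro z hz
  have hzi : ∀ i, update c i (z i) ∈ U := fun i =>
    hU.update_mem hc (harm i) ⟨(min_le_left _ _).trans (hz.1 i), (hz.2 i).trans (le_max_right _ _)⟩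
  -- induction on the set of coordinates taken from `z`
  have key : ∀ s : Finset ι, (fun j => if j ∈ s then z j else c j) ∈ U := by
    intro s
    induction s using Finset.induction_on with
    | empty => simpa using hc
    | @insert a s ha ih =>
      have e : (fun j => if j ∈ insert a s then z j else c j) =
          (fun j => if j ∈ s then z j else c j) ⊔ update c a (z a) := by
        funext j
        simp only [Finset.mem_insert, Pi.sup_apply]
        by_cases hja : j = a
        · subst hja
          simp only [true_or, if_true, update_self, if_neg ha]
          exact (max_eq_right (hz.1 j)).symm
        · simp only [hja, false_or, update_of_ne hja]
          by_cases hjs : j ∈ s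
          · simp only [hjs, if_true]; exact (max_eq_left (hz.1 j)).symm
          · simp only [hjs, if_false]; exact (max_self _).symm
      rw [e]
      exact hU.sup_mem _ ih _ (hzi a)
  have e : (fun j => if j ∈ (Finset.univ : Finset ι) then z j else c j) = z := by
    funext j; simp
  rw [← e]
  exact key _

/-- **An arm box spans boxes inside `U`**: `[c, p] ⊆ U` for `p ∈ armBox U c`, `c ∈ U`. [this work] -/
theorem IsOpenBand.Icc_subset_of_mem_armBox {U : Set (ι → ℝ)} (hU : IsOpenBand U) {c p : ι → ℝ} (hc : c ∈ U)
    (hp : p ∈ armBox U c) : Icc c p ⊆ U :=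
  hU.Icc_subset hc hp.2

/-- An arm box lies in `U`. [folklore] -/
theorem IsOpenBand.armBox_subset {U : Set (ι → ℝ)} (hU : IsOpenBand U) {c : ι → ℝ} (hc : c ∈ U) :
    armBox U c ⊆ U := fun _ hp => hU.Icc_subset_of_mem_armBox hc hp ⟨fun i => (hp.1 i).le, le_rfl⟩

omit [Fintype ι] [DecidableEq ι] in
/-- Strict upper orthants are open. [folklore] -/
theorem isOpen_setOf_forall_gt' [Finite ι] (c : ι → ℝ) : IsOpen {p : ι → ℝ | ∀ i, c i < p i} := by
  rw [Set.setOf_forall]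
  exact isOpen_iInter_of_finite fun i => isOpen_lt continuous_const (continuous_apply i)

omit [Fintype ι] in
/-- Arm boxes are open. [folklore] -/
theorem isOpen_armBox [Finite ι] {U : Set (ι → ℝ)} (hU : IsOpen U) (c : ι → ℝ) : IsOpen (armBox U c) := by
  have e : armBox U c = {p | ∀ i, c i < p i} ∩ ⋂ i, (fun p : ι → ℝ => update c i (p i)) ⁻¹' U := by
    ext p; simp only [armBox, Set.mem_setOf_eq, Set.mem_inter_iff, Set.mem_iInter, Set.mem_preimage]
  rw [e]
  exact (isOpen_setOf_forall_gt' c).inter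
    (isOpen_iInter_of_finite fun i => hU.preimage (continuous_const.update i (continuous_apply i)))

omit [Fintype ι] in
/-- Arm boxes are measurable. [folklore] -/
theorem measurableSet_armBox [Finite ι] {U : Set (ι → ℝ)} (hU : IsOpen U) (c : ι → ℝ) :
    MeasurableSet (armBox U c) := (isOpen_armBox hU c).measurableSet

omit [Fintype ι] in
/-- Arm boxes are closed under meet. [folklore] -/
theorem inf_mem_armBox {U : Set (ι → ℝ)} {c p q : ι → ℝ} (hp : p ∈ armBox U c) (hq : q ∈ armBox U c) :
    p ⊓ q ∈ armBox U c := by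
  refine ⟨fun i => lt_min (hp.1 i) (hq.1 i), fun i => ?_⟩
  simp only [Pi.inf_apply]
  rcases le_total (p i) (q i) with h | h
  · rw [min_eq_left h]; exact hp.2 i
  · rw [min_eq_right h]; exact hq.2 i

omit [Fintype ι] in
/-- Arm boxes are closed under join. [folklore] -/
theorem sup_mem_armBox' {U : Set (ι → ℝ)} {c p q : ι → ℝ} (hp : p ∈ armBox U c) (hq : q ∈ armBox U c) :
    p ⊔ q ∈ armBox U c := by
  refine ⟨fun i => (hp.1 i).trans_le (le_max_left _ _), fun i => ?_⟩
  simp only [Pi.sup_apply]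
  rcases le_total (p i) (q i) with h | h
  · rw [max_eq_right h]; exact hq.2 i
  · rw [max_eq_left h]; exact hp.2 i

omit [Fintype ι] in
/-- Points of an arm box below a given point of it. [folklore] -/
theorem mem_armBox_of_le {U : Set (ι → ℝ)} (hU : IsOpenBand U) {c p x : ι → ℝ} (hc : c ∈ U) (hp : p ∈ armBox U c)
    (hcx : ∀ i, c i < x i) (hxp : x ≤ p) : x ∈ armBox U c :=
  ⟨hcx, fun i => hU.update_mem hc (hp.2 i)
    ⟨(min_le_left _ _).trans (hcx i).le, (hxp i).trans (le_max_right _ _)⟩⟩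

/-- **Every point of `U` lies in the arm box of a member of any dense family of points of `U`.** [this work] -/
theorem IsOpenBand.exists_mem_armBox {U : Set (ι → ℝ)} (hU : IsOpenBand U) {c : ℕ → ι → ℝ}
    (hd : ∀ O : Set (ι → ℝ), IsOpen O → O.Nonempty → O ⊆ U → ∃ k, c k ∈ O) {p : ι → ℝ} (hp : p ∈ U) :
    ∃ k, p ∈ armBox U (c k) := by
  obtain ⟨δ, hδ, hball⟩ := Metric.isOpen_iff.1 hU.isOpen p hp
  set O : Set (ι → ℝ) := {z | ∀ i, p i - δ / 2 < z i ∧ z i < p i} with hO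
  have hOo : IsOpen O := by
    rw [hO, Set.setOf_forall]
    exact isOpen_iInter_of_finite fun i => (isOpen_lt continuous_const (continuous_apply i)).inter
      (isOpen_lt (continuous_apply i) continuous_const)
  have hdist : ∀ z : ι → ℝ, (∀ i, |z i - p i| < δ) → z ∈ U := fun z hz =>
    hball (by rw [Metric.mem_ball, dist_pi_lt_iff hδ]; exact fun i => by rw [Real.dist_eq]; exact hz i)
  have hOU : O ⊆ U := fun z hz => hdist z fun i => by
    rw [abs_lt]; constructor <;> linarith [(hz i).1, (hz i).2]
  have hOne : O.Nonempty := ⟨fun i => p i - δ / 4, fun i => by constructor <;> linarith⟩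
  obtain ⟨k, hk⟩ := hd O hOo hOne hOU
  refine ⟨k, fun i => (hk i).2, fun i => hdist _ fun j => ?_⟩
  by_cases hj : j = i
  · subst hj; rw [update_self, sub_self, abs_zero]; exact hδ
  · rw [update_of_ne hj, abs_lt]; constructor <;> linarith [(hk j).1, (hk j).2]

/-- **Base points slightly below a point of `U` whose `i`-lines stay in `U` near it.**  For `w ∈ U` and a dense family,
some member `c_k < w` (all coordinates) has `(c_k; i := t) ∈ U` for all `t` near `wᵢ`. [this work] -/
theorem IsOpenBand.exists_below_line {U : Set (ι → ℝ)} (hU : IsOpenBand U) {c : ℕ → ι → ℝ}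
    (hd : ∀ O : Set (ι → ℝ), IsOpen O → O.Nonempty → O ⊆ U → ∃ k, c k ∈ O) {w : ι → ℝ} (hw : w ∈ U) (i : ι) :
    ∃ k, (∀ j, c k j < w j) ∧ ∃ ε > 0, ∀ t, |t - w i| < ε → update (c k) i t ∈ U := by
  obtain ⟨δ, hδ, hball⟩ := Metric.isOpen_iff.1 hU.isOpen w hw
  set O : Set (ι → ℝ) := {z | ∀ j, w j - δ / 2 < z j ∧ z j < w j} with hO
  have hOo : IsOpen O := by
    rw [hO, Set.setOf_forall]
    exact isOpen_iInter_of_finite fun j => (isOpen_lt continuous_const (continuous_apply j)).inter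
      (isOpen_lt (continuous_apply j) continuous_const)
  have hdist : ∀ z : ι → ℝ, (∀ j, |z j - w j| < δ) → z ∈ U := fun z hz =>
    hball (by rw [Metric.mem_ball, dist_pi_lt_iff hδ]; exact fun j => by rw [Real.dist_eq]; exact hz j)
  have hOU : O ⊆ U := fun z hz => hdist z fun j => by
    rw [abs_lt]; constructor <;> linarith [(hz j).1, (hz j).2]
  have hOne : O.Nonempty := ⟨fun j => w j - δ / 4, fun j => by constructor <;> linarith⟩
  obtain ⟨k, hk⟩ := hd O hOo hOne hOU
  refine ⟨k, fun j => (hk j).2, δ / 2, by positivity, fun t ht => hdist _ fun j => ?_⟩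
  by_cases hj : j = i
  · subst hj; rw [update_self]; linarith [hδ]
  · rw [update_of_ne hj, abs_lt]; constructor <;> linarith [(hk j).1, (hk j).2]

/-! ### One-sided dichotomy for order-convex subsets of the line -/

/-- **Left dichotomy**: an order-convex subset of `ℝ` either contains a whole left neighbourhood of `t₀` or misses a
whole (punctured) left neighbourhood of `t₀`. [folklore] -/
theorem eventually_mem_or_eventually_not_mem_nhdsLT {S : Set ℝ} (hS : OrdConnected S) (t₀ : ℝ) :
    (∀ᶠ t in 𝓝[<] t₀, t ∈ S) ∨ (∀ᶠ t in 𝓝[<] t₀, t ∉ S) := by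
  by_cases h : ∃ s < t₀, Ioo s t₀ ⊆ S
  · obtain ⟨s, hs, hsub⟩ := h
    exact Or.inl (mem_of_superset (Ioo_mem_nhdsLT hs) hsub)
  · right
    push Not at h
    by_cases h' : ∃ w ∈ S, w < t₀
    · obtain ⟨w, hwS, hwt⟩ := h'
      obtain ⟨u, hu, huS⟩ := Set.not_subset.1 (h w hwt)
      filter_upwards [Ioo_mem_nhdsLT hu.2] with v hv hvS
      exact huS (hS.out hwS hvS ⟨hu.1.le, hv.1.le⟩)
    · push Not at h'
      filter_upwards [self_mem_nhdsWithin] with v hv hvS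
      exact absurd (h' v hvS) (not_le.2 hv)

end Summit.CriticalPhenomena.PercolationContinuityZ3.Theorems.SahiAEFourFunctions
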